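import Summits.AtomisticToContinuum.FouriersLaw.Theorems.EmbeddedDrudeMourreFGRGapOddC1A

/-!
# FGRGap · line `fold-jet-rigidity` · stub `stub_noOddC1Invariant`: no odd `C¹` collisional invariant

The registered stub `stub_noOddC1Invariant` (S1) of the lead's skeleton for crux
`EmbeddedDrudeMourre.FGRGap` (stmt-AtomisticToContinuum-12595), with exactly the registered signature:
for `ω₂ > 0`, every odd `C¹` `2π`-periodic collisional invariant `ψ` of the pinned band
`ω(k) = √(ω₂ + 2(1 - cos k))` (`ψ₁ + ψ₂ = ψ₃ + ψ₄` whenever `ω₁ + ω₂ = ω₃ + ω₄`, `k₄ = k₁ + k₂ - k₃`)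
vanishes identically. Only the band and its group velocity `v = sin/ω` enter (vertex-free).

Proof (part A = `…FGRGapOddC1A`: the explicit velocity involution `σ` with `v ∘ σ = v`):
1. PARITY RESONANCE (`apply_pi_sub`): `(k, π - k; -k, π + k)` is resonant for every `k`
   (`ω` even, `ω (π - k) = ω (π + k)`), so `ψ (π - k) = -ψ k` and `ψ' (π - k) = ψ' k`.
2. GRAZING LAW (`deriv_eq_of_groupVelocity_eq`): if `v y = v k` and `v' y ≠ 0` then `ψ' k = ψ' y`.
   For small `t > 0` the function `K ↦ Ω(k, K, k + t) = [ω k - ω (k+t)] + [ω K - ω (K-t)]` is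
   `≈ t (v K - v k)` and changes sign between `y - δ` and `y + δ` (the slopes of `ω` are within `e`
   of `v`, and `v (y ± δ) - v k` have opposite signs because `v' y ≠ 0`); the intermediate value
   theorem gives a genuine resonance `(k, K; k + t, K - t)` with `|K - y| ≤ δ`, the invariant identity
   reads `[ψ (k+t) - ψ k]/t = [ψ K - ψ (K-t)]/t = ψ' ξ` (mean value theorem) with `|ξ - y| < 2δ`, and
   continuity of `ψ'` at `y` plus differentiability of `ψ` at `k` give `|ψ' k - ψ' y| < ε`.
3. DESCENT (part A, `le_apply_zero_of_invariant`): `ψ'` is continuous, invariant under `π - ·` and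
   under `σ` on `(0, π)` (by 2., since `σ x ≠ x ⇒ v' (σ x) ≠ 0`), hence `ψ' ≤ ψ' 0` on `[0, π]`; the
   same for `-ψ`, so `ψ'` is constant on `[0, π]`, hence on `ℝ` (`ψ'` is even and `2π`-periodic).
4. `ψ x = C x` (`ψ 0 = 0`), and periodicity forces `C = 0`.

References: Aoki–Lukkarinen–Spohn 2006 §4 (4.9) (collisional invariants of the pinned band);
Lukkarinen–Spohn 2008 §5. The argument itself is elementary real analysis (folklore).
-/

noncomputable section

open MeasureTheory Set Real Filter Topology
open scoped ENNReal
open Literature.MathematicalPhysics.KineticTheory.PhononBoltzmann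
open Summit.AtomisticToContinuum.FouriersLaw.Theorems.FGRGap

namespace Summit.AtomisticToContinuum.FouriersLaw.Theorems.FGRGap.FoldJetRigidity

namespace OddC1

variable {ω₂ : ℝ} {ψ : ℝ → ℝ}

/-! ## 1. Parity resonance -/

/-- **Parity resonance.** `(k, π - k; -k, π + k)` is resonant for every `k` (`ω` is even and
`2π`-periodic, so `ω (π - k) = ω (π + k)`); hence an odd `2π`-periodic collisional invariant satisfies
`ψ (π - k) = -ψ k`. [folklore] -/
theorem apply_pi_sub (hper : Function.Periodic ψ (2 * π)) (hodd : Function.Odd ψ)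
    (hinv : IsCollisionalInvariant ω₂ ψ) (k : ℝ) : ψ (π - k) = -ψ k := by
  have hres : dispersion ω₂ k + dispersion ω₂ (π - k) =
      dispersion ω₂ (-k) + dispersion ω₂ (k + (π - k) - -k) := by
    rw [dispersion_neg, show k + (π - k) - -k = (k - π) + 2 * π by ring, dispersion_periodic,
      show k - π = -(π - k) by ring, dispersion_neg]
  have h := hinv k (π - k) (-k) hres
  rw [show k + (π - k) - -k = (k - π) + 2 * π by ring, hper, show k - π = -(π - k) by ring, hodd,
    hodd] at h
  linarith

/-- `ψ'` is symmetric about `π/2`: `ψ' (π - k) = ψ' k`. [folklore] -/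
theorem deriv_pi_sub (hper : Function.Periodic ψ (2 * π)) (hodd : Function.Odd ψ)
    (hinv : IsCollisionalInvariant ω₂ ψ) (k : ℝ) : deriv ψ (π - k) = deriv ψ k := by
  have h : (fun x => ψ (π - x)) = fun x => -ψ x := funext (apply_pi_sub hper hodd hinv)
  have h1 : deriv (fun x => ψ (π - x)) k = -deriv ψ (π - k) := deriv_comp_const_sub ψ π k
  rw [h, deriv.fun_neg] at h1
  linarith

/-- The derivative of an odd function is even. [folklore] -/
theorem deriv_neg_eq (hodd : Function.Odd ψ) (k : ℝ) : deriv ψ (-k) = deriv ψ k := by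
  have h : (fun x => ψ (-x)) = fun x => -ψ x := funext hodd
  have h1 : deriv (fun x => ψ (-x)) k = -deriv ψ (-k) := deriv_comp_neg ψ k
  rw [h, deriv.fun_neg] at h1
  linarith

/-- The derivative of a `2π`-periodic function is `2π`-periodic. [folklore] -/
theorem deriv_periodic (hper : Function.Periodic ψ (2 * π)) :
    Function.Periodic (deriv ψ) (2 * π) := by
  intro k
  have h : (fun x => ψ (x + 2 * π)) = ψ := funext hper
  have h1 : deriv (fun x => ψ (x + 2 * π)) k = deriv ψ (k + 2 * π) := deriv_comp_add_const ψ _ k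
  rw [h] at h1
  exact h1.symm

/-! ## 2. The grazing law -/

/-- **Grazing law.** Let `ψ` be a `C¹` collisional invariant of the pinned band (`ω₂ > 0`). If two
momenta `k, y` have the same group velocity, `v y = v k`, and `y` is not critical (`v' y = d ≠ 0`),
then `ψ' k = ψ' y`. (Resonances `(k, K; k + t, K - t)` with `K → y` as `t → 0⁺` exist by the
intermediate value theorem applied to `K ↦ Ω(k, K, k+t) ≈ t (v K - v k)` on `[y - δ, y + δ]`; divide the
invariant identity by `t` and let `t → 0`, using the mean value theorem and continuity of `ψ'`.)
[folklore] -/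
theorem deriv_eq_of_groupVelocity_eq (hω : 0 < ω₂) (hψ : ContDiff ℝ 1 ψ)
    (hinv : IsCollisionalInvariant ω₂ ψ) {k y d : ℝ}
    (hv : groupVelocity ω₂ y = groupVelocity ω₂ k) (hd : HasDerivAt (groupVelocity ω₂) d y)
    (hd0 : d ≠ 0) : deriv ψ k = deriv ψ y := by
  have hdiff : Differentiable ℝ ψ := hψ.differentiable_one
  have hgc : Continuous (deriv ψ) := hψ.continuous_deriv_one
  have hψd : ∀ x, HasDerivAt ψ (deriv ψ x) x := fun x => (hdiff x).hasDerivAt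
  have hωd : ∀ x, HasDerivAt (dispersion ω₂) (groupVelocity ω₂ x) x := hasDerivAt_dispersion hω
  have hωc : Continuous (dispersion ω₂) :=
    continuous_iff_continuousAt.2 fun x => (hωd x).continuousAt
  apply eq_of_forall_dist_le
  intro ε hε
  rw [Real.dist_eq]
  -- (1) continuity of `ψ'` at `y`; (2) derivative of `ψ` at `k`; (3) derivative of `v` at `y`
  obtain ⟨δ₁, hδ₁, hg1⟩ := Metric.continuousAt_iff.1 (hgc.continuousAt (x := y)) (ε / 2) (half_pos hε)
  obtain ⟨δ₂, hδ₂, hψ2⟩ := exists_delta_of_hasDerivAt (hψd k) (half_pos hε)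
  obtain ⟨η, hη, hv3⟩ := exists_delta_of_hasDerivAt hd (half_pos (abs_pos.2 hd0))
  obtain ⟨δ, hδ, hδη, hδ1⟩ : ∃ δ : ℝ, 0 < δ ∧ δ < η ∧ 4 * δ ≤ δ₁ :=
    ⟨min (δ₁ / 4) (η / 2), lt_min (by positivity) (by positivity),
      (min_le_right _ _).trans_lt (by linarith), by linarith [min_le_left (δ₁ / 4) (η / 2)]⟩
  have hδ0 : δ ≠ 0 := hδ.ne'
  -- `v - v k` has opposite strict signs at `y - δ` and `y + δ`
  have hsP : 0 < d * (groupVelocity ω₂ (y + δ) - groupVelocity ω₂ y) := by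
    have := mul_pos (mul_pos_of_abs_sub_lt (hv3 δ hδ0 (by rwa [abs_of_pos hδ]))) hδ
    rwa [← mul_div_assoc, div_mul_cancel₀ _ hδ0] at this
  have hsM : d * (groupVelocity ω₂ (y - δ) - groupVelocity ω₂ y) < 0 := by
    have := mul_pos (mul_pos_of_abs_sub_lt
      (hv3 (-δ) (neg_ne_zero.2 hδ0) (by rwa [abs_neg, abs_of_pos hδ]))) hδ
    rw [← sub_eq_add_neg, ← mul_div_assoc, div_neg, neg_mul, div_mul_cancel₀ _ hδ0] at this
    linarith
  rw [hv] at hsP hsM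
  obtain ⟨p, q, hpI, hqI, hvp, hvq⟩ : ∃ p q : ℝ, p ∈ Icc (y - δ) (y + δ) ∧ q ∈ Icc (y - δ) (y + δ) ∧
      groupVelocity ω₂ p < groupVelocity ω₂ k ∧ groupVelocity ω₂ k < groupVelocity ω₂ q := by
    have hIP : y + δ ∈ Icc (y - δ) (y + δ) := ⟨by linarith, le_rfl⟩
    have hIM : y - δ ∈ Icc (y - δ) (y + δ) := ⟨le_rfl, by linarith⟩
    rcases lt_or_gt_of_ne hd0 with hneg | hpos
    · exact ⟨y + δ, y - δ, hIP, hIM, by nlinarith, by nlinarith⟩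
    · exact ⟨y - δ, y + δ, hIM, hIP, by nlinarith, by nlinarith⟩
  -- tolerance `e` and the slopes of `ω` at `k`, `p`, `q`
  obtain ⟨e, he, hep, heq⟩ : ∃ e : ℝ, 0 < e ∧ 4 * e ≤ groupVelocity ω₂ k - groupVelocity ω₂ p ∧
      4 * e ≤ groupVelocity ω₂ q - groupVelocity ω₂ k := by
    refine ⟨min (groupVelocity ω₂ k - groupVelocity ω₂ p)
      (groupVelocity ω₂ q - groupVelocity ω₂ k) / 4, ?_, ?_, ?_⟩
    · have := lt_min (sub_pos.2 hvp) (sub_pos.2 hvq)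
      positivity
    · linarith [min_le_left (groupVelocity ω₂ k - groupVelocity ω₂ p)
          (groupVelocity ω₂ q - groupVelocity ω₂ k)]
    · linarith [min_le_right (groupVelocity ω₂ k - groupVelocity ω₂ p)
          (groupVelocity ω₂ q - groupVelocity ω₂ k)]
  obtain ⟨τ₀, hτ₀, hω0⟩ := exists_delta_of_hasDerivAt (hωd k) he
  obtain ⟨τp, hτp, hωp⟩ := exists_delta_of_hasDerivAt (hωd p) he
  obtain ⟨τq, hτq, hωq⟩ := exists_delta_of_hasDerivAt (hωd q) he
  -- the time step `t`
  obtain ⟨t, ht, ht₀, htp, htq, ht₂, htδ⟩ :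
      ∃ t : ℝ, 0 < t ∧ t < τ₀ ∧ t < τp ∧ t < τq ∧ t < δ₂ ∧ t < δ := by
    set m := min (min (min τ₀ τp) (min τq δ₂)) δ with hm
    have hm0 : 0 < m := lt_min (lt_min (lt_min hτ₀ hτp) (lt_min hτq hδ₂)) hδ
    have h1 : m ≤ min (min τ₀ τp) (min τq δ₂) := min_le_left _ _
    have h2 : min (min τ₀ τp) (min τq δ₂) ≤ min τ₀ τp := min_le_left _ _
    have h3 : min (min τ₀ τp) (min τq δ₂) ≤ min τq δ₂ := min_le_right _ _
    refine ⟨m / 2, by positivity, ?_, ?_, ?_, ?_, ?_⟩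
    · linarith [min_le_left τ₀ τp]
    · linarith [min_le_right τ₀ τp]
    · linarith [min_le_left τq δ₂]
    · linarith [min_le_right τq δ₂]
    · linarith [min_le_right (min (min τ₀ τp) (min τq δ₂)) δ]
  have ht0 : t ≠ 0 := ht.ne'
  have habs : |t| < τ₀ ∧ |t| < τp ∧ |t| < τq ∧ |t| < δ₂ := by
    rw [abs_of_pos ht]; exact ⟨ht₀, htp, htq, ht₂⟩
  have hq0 := hω0 t ht0 habs.1
  have hqp := hωp (-t) (neg_ne_zero.2 ht0) (by rw [abs_neg]; exact habs.2.1)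
  have hqq := hωq (-t) (neg_ne_zero.2 ht0) (by rw [abs_neg]; exact habs.2.2.1)
  rw [← sub_eq_add_neg] at hqp hqq
  rw [abs_lt] at hq0 hqp hqq
  have e0 : dispersion ω₂ (k + t) - dispersion ω₂ k =
      t * ((dispersion ω₂ (k + t) - dispersion ω₂ k) / t) := by field_simp
  have ep : dispersion ω₂ (p - t) - dispersion ω₂ p =
      -(t * ((dispersion ω₂ (p - t) - dispersion ω₂ p) / -t)) := by field_simp
  have eq' : dispersion ω₂ (q - t) - dispersion ω₂ q =
      -(t * ((dispersion ω₂ (q - t) - dispersion ω₂ q) / -t)) := by field_simp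
  -- `F K := ω k + ω K - ω (k + t) - ω (K - t)` has `F p < 0 < F q`
  have hFp : dispersion ω₂ k + dispersion ω₂ p - dispersion ω₂ (k + t) - dispersion ω₂ (p - t) < 0 := by
    nlinarith [mul_pos ht (show 0 < (dispersion ω₂ (k + t) - dispersion ω₂ k) / t -
      (dispersion ω₂ (p - t) - dispersion ω₂ p) / -t by linarith)]
  have hFq : 0 < dispersion ω₂ k + dispersion ω₂ q - dispersion ω₂ (k + t) - dispersion ω₂ (q - t) := by
    nlinarith [mul_pos ht (show 0 < (dispersion ω₂ (q - t) - dispersion ω₂ q) / -t -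
      (dispersion ω₂ (k + t) - dispersion ω₂ k) / t by linarith)]
  -- intermediate value theorem: a genuine resonance `(k, K; k + t, K - t)` with `|K - y| ≤ δ`
  have hFc : Continuous fun K =>
      dispersion ω₂ k + dispersion ω₂ K - dispersion ω₂ (k + t) - dispersion ω₂ (K - t) :=
    ((continuous_const.add hωc).sub continuous_const).sub (hωc.comp (continuous_id.sub continuous_const))
  obtain ⟨K, hK, hFK⟩ : ∃ K ∈ uIcc p q,
      dispersion ω₂ k + dispersion ω₂ K - dispersion ω₂ (k + t) - dispersion ω₂ (K - t) = 0 :=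
    intermediate_value_uIcc hFc.continuousOn (mem_uIcc.2 (Or.inl ⟨hFp.le, hFq.le⟩))
  have hKI : K ∈ Icc (y - δ) (y + δ) := uIcc_subset_Icc hpI hqI hK
  have hres := hinv k K (k + t) (by rw [show k + K - (k + t) = K - t by ring]; linarith)
  rw [show k + K - (k + t) = K - t by ring] at hres
  -- mean value theorem on `[K - t, K]`
  obtain ⟨ξ, hξ, hξeq⟩ := exists_deriv_eq_slope ψ (show K - t < K by linarith)
    hdiff.continuous.continuousOn (hdiff.differentiableOn.mono (subset_univ _))
  rw [show K - (K - t) = t by ring] at hξeq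
  have h1 := hψ2 t ht0 habs.2.2.2
  have h2 : (ψ (k + t) - ψ k) / t = deriv ψ ξ := by
    rw [hξeq]
    congr 1
    linarith
  have hξy : dist ξ y < δ₁ := by
    rw [Real.dist_eq, abs_lt]
    constructor <;> linarith [hξ.1, hξ.2, hKI.1, hKI.2]
  have h3 := hg1 hξy
  rw [Real.dist_eq] at h3
  rw [h2] at h1
  calc |deriv ψ k - deriv ψ y| = |(deriv ψ ξ - deriv ψ y) - (deriv ψ ξ - deriv ψ k)| := by ring_nf
    _ ≤ |deriv ψ ξ - deriv ψ y| + |deriv ψ ξ - deriv ψ k| := abs_sub _ _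
    _ ≤ ε := by linarith

/-! ## 3. Descent and assembly -/

/-- For an odd `C¹` `2π`-periodic collisional invariant `ψ` (`ω₂ > 0`), `ψ' ≤ ψ' 0` on `[0, π]`:
`ψ'` is continuous, symmetric about `π/2` (parity) and invariant under the velocity involution `σ` on
`(0, π)` (grazing law; at a fixed point of `σ` there is nothing to prove, elsewhere `v' (σ x) ≠ 0`),
so the descent lemma of part A applies. [folklore] -/
theorem deriv_le_deriv_zero (hω : 0 < ω₂) (hψ : ContDiff ℝ 1 ψ)
    (hper : Function.Periodic ψ (2 * π)) (hodd : Function.Odd ψ)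
    (hinv : IsCollisionalInvariant ω₂ ψ) : ∀ x ∈ Icc 0 π, deriv ψ x ≤ deriv ψ 0 := by
  obtain ⟨σ, hσI, hσa, hσσ, hσo, hσv, hσπ, hσfix⟩ := exists_velocityInvolution hω
  refine le_apply_zero_of_invariant hσI hσa hσσ hσo hσπ hψ.continuous_deriv_one
    (deriv_pi_sub hper hodd hinv) ?_
  intro x hx
  by_cases hfix : σ x = x
  · rw [hfix]
  · have hd := hasDerivAt_groupVelocity hω (σ x)
    have hd0 : ((ω₂ + 2) * Real.cos (σ x) - Real.cos (σ x) ^ 2 - 1) / dispersion ω₂ (σ x) ^ 3 ≠ 0 := by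
      intro h0
      rcases div_eq_zero_iff.1 h0 with h0 | h0
      · exact hfix (hσfix x (Ioo_subset_Icc_self hx) h0)
      · exact (pow_pos (dispersion_pos hω _) 3).ne' h0
    exact (deriv_eq_of_groupVelocity_eq hω hψ hinv (hσv x (Ioo_subset_Icc_self hx)) hd hd0).symm

/-- For an odd `C¹` `2π`-periodic collisional invariant `ψ` (`ω₂ > 0`), `ψ'` is constant on `ℝ`
(`deriv_le_deriv_zero` for `ψ` and `-ψ` on `[0, π]`; `ψ'` is even and `2π`-periodic). [folklore] -/
theorem deriv_eq_deriv_zero (hω : 0 < ω₂) (hψ : ContDiff ℝ 1 ψ)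
    (hper : Function.Periodic ψ (2 * π)) (hodd : Function.Odd ψ)
    (hinv : IsCollisionalInvariant ω₂ ψ) (x : ℝ) : deriv ψ x = deriv ψ 0 := by
  have h1 := deriv_le_deriv_zero hω hψ hper hodd hinv
  have hψ' : ContDiff ℝ 1 (-ψ) := hψ.neg
  have hper' : Function.Periodic (-ψ) (2 * π) := fun z => by simp [hper z]
  have hodd' : Function.Odd (-ψ) := fun z => by simp [hodd z]
  have hinv' : IsCollisionalInvariant ω₂ (-ψ) := by simpa using hinv.smul (-1)
  have h2 := deriv_le_deriv_zero hω hψ' hper' hodd' hinv'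
  simp only [deriv.neg', neg_le_neg_iff] at h2
  have hI : ∀ z ∈ Icc 0 π, deriv ψ z = deriv ψ 0 := fun z hz => le_antisymm (h1 z hz) (h2 z hz)
  obtain ⟨y, hy, hxy⟩ := (deriv_periodic hper).exists_mem_Ico Real.two_pi_pos x (-π)
  rw [hxy]
  rcases le_or_gt 0 y with h | h
  · exact hI y ⟨h, by linarith [hy.2]⟩
  · rw [← deriv_neg_eq hodd]
    exact hI (-y) ⟨by linarith, by linarith [hy.1]⟩

end OddC1

open OddC1 in
/-- **S1 — no odd `C¹` collisional invariant on the pinned band** (registered stub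
`stub_noOddC1Invariant` of line `fold-jet-rigidity`, crux `EmbeddedDrudeMourre.FGRGap`; verbatim also
stub 6 of line `log-coercive-compact-resolvent`). For every `ω₂ > 0`, an odd `C¹` `2π`-periodic `ψ` with
`ψ k₁ + ψ k₂ = ψ k₃ + ψ (k₁ + k₂ - k₃)` whenever `ω k₁ + ω k₂ = ω k₃ + ω (k₁ + k₂ - k₃)`,
`ω = √(ω₂ + 2(1 - cos ·))`, vanishes identically: by parity resonance, the grazing law and descent
along the velocity involution `ψ'` is constant, so `ψ` is linear and odd, and periodicity kills it.
[cite: AokiLukkarinenSpohn2006, §4 eq. (4.9)] -/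
theorem stub_noOddC1Invariant :
    ∀ ω₂ : ℝ, 0 < ω₂ → ∀ ψ : ℝ → ℝ, ContDiff ℝ 1 ψ → Function.Periodic ψ (2 * π) →
      Function.Odd ψ → IsCollisionalInvariant ω₂ ψ → ∀ k : ℝ, ψ k = 0 := by
  intro ω₂ hω ψ hψ hper hodd hinv k
  have hC : ∀ x, deriv ψ x = deriv ψ 0 := deriv_eq_deriv_zero hω hψ hper hodd hinv
  have hdiff : Differentiable ℝ ψ := hψ.differentiable_one
  have h0 : ψ 0 = 0 := by
    have := hodd 0
    rw [neg_zero] at this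
    linarith
  have hlin : ∀ x, ψ x = deriv ψ 0 * x := by
    intro x
    have hd : Differentiable ℝ fun z => ψ z - deriv ψ 0 * z :=
      hdiff.sub ((differentiable_id).const_mul _)
    have hz : ∀ z, deriv (fun z => ψ z - deriv ψ 0 * z) z = 0 := by
      intro z
      rw [((hdiff z).hasDerivAt.fun_sub
        ((hasDerivAt_id' z).const_mul (deriv ψ 0))).deriv, hC z]
      ring
    have h := is_const_of_deriv_eq_zero hd hz x 0
    simp only [mul_zero, sub_zero, h0] at h
    linarith
  have hCzero : deriv ψ 0 = 0 := by
    have h := hper 0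
    rw [zero_add, hlin (2 * π), h0] at h
    have : (2 * π) ≠ 0 := by positivity
    exact (mul_eq_zero.1 h).resolve_right this
  rw [hlin, hCzero, zero_mul]

end Summit.AtomisticToContinuum.FouriersLaw.Theorems.FGRGap.FoldJetRigidity

end
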